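import Summits.CriticalPhenomena.SAWScalingLimit.Theorems.SAWLeftRightFKGFKGToTraversalBoundOutlineTour
import HarnessLib

/-!
# Body refinement of a site set, part 1: membership in the fine body and the one-step simulation

Crux `SAWLeftRightFKG.FKGToTraversalBound` (stmt-CriticalPhenomena-1878), line `slit-necklace`, lead
prover-line-stmt-CriticalPhenomena-1878-c5-0; boundary-budget unit U6, sub-unit BB3 (body refinement), on top of
`…SlitNecklaceOutline` (`ODir`, `IsBEdge`, `bnext`, `btour`) and `…OutlineTour` (`bnext_eq_of_*`, `vec_ccw_ccw`).

For a coarse site set `B ⊆ ℤ²` and a scale `M ≥ 2` the FINE BODY `A` consists of the scaled sites `M • x`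
(`x ∈ B`), the `M - 1` fine sites strictly inside every body edge (`x`, `x + d` both in `B`) and the `(M - 1)²`
fine sites strictly inside every full unit square of `B`.  This file proves:
* `bbt_mem_frame` — membership in `A` of a fine site written in the frame `(d, d.ccw)` at a coarse site;
* `bbt_isBEdge_scale` — a boundary edge `(x, d)` of `B` scales to the boundary edge `(M • x, d)` of `A`;
* `bbt_step` (registered) — ONE-STEP SIMULATION: the wall-follower tour of `A` started at `(M • x, d)` reaches the
  scaled successor `bnext B (x, d)` after `L ∈ {1, M, 2M - 1}` steps, through explicitly listed fine edges;
* `bbt_nocollide` — the listed fine edges of distinct (boundary edge, offset) pairs are distinct.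

All statements folklore (boundary tracing of a polyomino and of its refinement); no literature fact; nothing
restates the crux.
-/

noncomputable section

open Literature.Probability.LatticeModels

namespace Summit.CriticalPhenomena.SAWScalingLimit.Theorems.FKGToTraversalBound.SlitNecklace

/-! ### Arithmetic of scaled coordinates -/

/-- Division with remainder is unique: `M a + s = M b + t` with `0 ≤ s, t < M` forces `a = b`, `s = t`. [folklore] -/
theorem bbt_zuniq {M a b s t : ℤ} (hs : 0 ≤ s) (hsM : s < M) (ht : 0 ≤ t) (htM : t < M)
    (h : M * a + s = M * b + t) : a = b ∧ s = t := by
  have hM : M ≠ 0 := by omega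
  have key : ∀ {c u : ℤ}, 0 ≤ u → u < M → (M * c + u) / M = c := by
    intro c u hu huM
    rw [add_comm, Int.add_mul_ediv_left _ _ hM, Int.ediv_eq_zero_of_lt hu huM, zero_add]
  have hab : a = b := by rw [← key (c := a) hs hsM, h, key ht htM]
  subst hab
  exact ⟨rfl, by omega⟩

/-- The four directions. [folklore] -/
theorem bbt_dir_cases (d : ODir) : d = 0 ∨ d = 1 ∨ d = 2 ∨ d = 3 := by
  fin_cases d <;> simp

/-- Uniqueness of the representation `M • x + t₁ • E + t₂ • N` with `0 ≤ t₁, t₂ < M`. [folklore] -/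
theorem bbt_rep_unique {M : ℕ} {x y : Site 2} {t₁ t₂ s₁ s₂ : ℤ} (h₁ : 0 ≤ t₁) (h₁M : t₁ < M)
    (h₂ : 0 ≤ t₂) (h₂M : t₂ < M) (g₁ : 0 ≤ s₁) (g₁M : s₁ < M) (g₂ : 0 ≤ s₂) (g₂M : s₂ < M)
    (h : (M : ℤ) • x + t₁ • ODir.vec 0 + t₂ • ODir.vec 1 = (M : ℤ) • y + s₁ • ODir.vec 0 + s₂ • ODir.vec 1) :
    x = y ∧ t₁ = s₁ ∧ t₂ = s₂ := by
  have e0 := congrFun h 0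
  have e1 := congrFun h 1
  simp [ODir.vec] at e0 e1
  obtain ⟨a0, rfl⟩ := bbt_zuniq h₁ h₁M g₁ g₁M e0
  obtain ⟨a1, rfl⟩ := bbt_zuniq h₂ h₂M g₂ g₂M e1
  exact ⟨funext fun i => by fin_cases i <;> assumption, rfl, rfl⟩

/-- Uniqueness of the representation `M • x + t • d` with `0 ≤ t < M` along a fixed direction. [folklore] -/
theorem bbt_line_unique {M : ℕ} (d : ODir) {x y : Site 2} {t s : ℤ} (ht : 0 ≤ t) (htM : t < M)
    (hs : 0 ≤ s) (hsM : s < M) (h : (M : ℤ) • x + t • d.vec = (M : ℤ) • y + s • d.vec) :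
    x = y ∧ t = s := by
  have hM : M ≠ 0 := by rintro rfl; omega
  have e0 := congrFun h 0
  have e1 := congrFun h 1
  obtain rfl | rfl | rfl | rfl := bbt_dir_cases d <;> simp [ODir.vec] at e0 e1
  · obtain ⟨a0, rfl⟩ := bbt_zuniq ht htM hs hsM e0
    exact ⟨funext fun i => by fin_cases i <;> [exact a0; exact e1.resolve_right hM], rfl⟩
  · obtain ⟨a1, rfl⟩ := bbt_zuniq ht htM hs hsM e1
    exact ⟨funext fun i => by fin_cases i <;> [exact e0.resolve_right hM; exact a1], rfl⟩
  · obtain ⟨a0, rfl⟩ := bbt_zuniq ht htM hs hsM (by linarith : (M : ℤ) * y 0 + t = M * x 0 + s)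
    exact ⟨funext fun i => by fin_cases i <;> [exact a0.symm; exact e1.resolve_right hM], rfl⟩
  · obtain ⟨a1, rfl⟩ := bbt_zuniq ht htM hs hsM (by linarith : (M : ℤ) * y 1 + t = M * x 1 + s)
    exact ⟨funext fun i => by fin_cases i <;> [exact e0.resolve_right hM; exact a1.symm], rfl⟩

/-- **Change of frame**: membership read in the frame `(d, d.ccw)` transfers to the frame `(d.ccw, d.ccw.ccw)`.
[folklore] -/
theorem bbt_frame_rot {B A : Finset (Site 2)} {M : ℕ} (d : ODir)
    (H : ∀ (x : Site 2) (t₁ t₂ : ℤ), 0 ≤ t₁ → t₁ < M → 0 ≤ t₂ → t₂ < M →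
      ((M : ℤ) • x + t₁ • d.vec + t₂ • d.ccw.vec ∈ A ↔ (x ∈ B ∧ (0 < t₁ → x + d.vec ∈ B) ∧
        (0 < t₂ → x + d.ccw.vec ∈ B) ∧ (0 < t₁ → 0 < t₂ → x + d.vec + d.ccw.vec ∈ B))))
    (x : Site 2) (t₁ t₂ : ℤ) (h₁ : 0 ≤ t₁) (h₁M : t₁ < M) (h₂ : 0 ≤ t₂) (h₂M : t₂ < M) :
    (M : ℤ) • x + t₁ • d.ccw.vec + t₂ • d.ccw.ccw.vec ∈ A ↔ (x ∈ B ∧ (0 < t₁ → x + d.ccw.vec ∈ B) ∧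
      (0 < t₂ → x + d.ccw.ccw.vec ∈ B) ∧ (0 < t₁ → 0 < t₂ → x + d.ccw.vec + d.ccw.ccw.vec ∈ B)) := by
  rcases h₂.eq_or_lt with rfl | h₂'
  · have e : (M : ℤ) • x + t₁ • d.ccw.vec + (0 : ℤ) • d.ccw.ccw.vec = (M : ℤ) • x + (0 : ℤ) • d.vec + t₁ • d.ccw.vec := by
      module
    rw [e, H x 0 t₁ le_rfl (by omega) h₁ h₁M]
    simp
  · have e : (M : ℤ) • x + t₁ • d.ccw.vec + t₂ • d.ccw.ccw.vec =
        (M : ℤ) • (x + d.ccw.ccw.vec) + ((M : ℤ) - t₂) • d.vec + t₁ • d.ccw.vec := by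
      rw [ODir.vec_ccw_ccw]; module
    rw [e, H (x + d.ccw.ccw.vec) (M - t₂) t₁ (by omega) (by omega) h₁ h₁M]
    have e2 : x + d.ccw.ccw.vec + d.vec = x := by rw [ODir.vec_ccw_ccw]; abel
    have e4 : x + d.ccw.ccw.vec + d.ccw.vec = x + d.ccw.vec + d.ccw.ccw.vec := add_right_comm _ _ _
    rw [e2, e4]
    have hp : (0 : ℤ) < M - t₂ := by omega
    simp only [hp, h₂', true_implies]
    tauto

section Mem

variable {B A : Finset (Site 2)} {M : ℕ} (hM : 2 ≤ M)
  (hA : ∀ f : Site 2, f ∈ A ↔ ((∃ x ∈ B, f = (M : ℤ) • x) ∨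
    (∃ x ∈ B, ∃ d : ODir, x + d.vec ∈ B ∧ ∃ t : ℤ, 0 < t ∧ t < M ∧ f = (M : ℤ) • x + t • d.vec) ∨
    (∃ x ∈ B, x + ODir.vec 0 ∈ B ∧ x + ODir.vec 1 ∈ B ∧ x + ODir.vec 0 + ODir.vec 1 ∈ B ∧ ∃ t₁ t₂ : ℤ,
      0 < t₁ ∧ t₁ < M ∧ 0 < t₂ ∧ t₂ < M ∧ f = (M : ℤ) • x + t₁ • ODir.vec 0 + t₂ • ODir.vec 1)))
include hM hA

/-- **Normal form**: every fine site of `A` is `M • y + s₁ • E + s₂ • N` with `0 ≤ s₁, s₂ < M`, `y ∈ B`, and the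
corners of the coarse cell that the offsets point into are in `B`. [folklore] -/
theorem bbt_rep {f : Site 2} (hf : f ∈ A) : ∃ (y : Site 2) (s₁ s₂ : ℤ), 0 ≤ s₁ ∧ s₁ < M ∧ 0 ≤ s₂ ∧ s₂ < M ∧
    f = (M : ℤ) • y + s₁ • ODir.vec 0 + s₂ • ODir.vec 1 ∧ y ∈ B ∧ (0 < s₁ → y + ODir.vec 0 ∈ B) ∧
    (0 < s₂ → y + ODir.vec 1 ∈ B) ∧ (0 < s₁ → 0 < s₂ → y + ODir.vec 0 + ODir.vec 1 ∈ B) := by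
  have hM0 : (0 : ℤ) < M := by exact_mod_cast (by omega : 0 < M)
  rcases (hA f).1 hf with ⟨x, hx, rfl⟩ | ⟨x, hx, d, hxd, t, ht, htM, rfl⟩ |
    ⟨x, hx, hE, hN, hEN, t₁, t₂, h₁, h₁M, h₂, h₂M, rfl⟩
  · exact ⟨x, 0, 0, le_rfl, hM0, le_rfl, hM0, by simp, hx, fun h => absurd h (lt_irrefl _),
      fun h => absurd h (lt_irrefl _), fun h => absurd h (lt_irrefl _)⟩
  · obtain rfl | rfl | rfl | rfl := bbt_dir_cases d
    · exact ⟨x, t, 0, ht.le, htM, le_rfl, hM0, by simp, hx, fun _ => hxd, fun h => absurd h (lt_irrefl _),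
        fun _ h => absurd h (lt_irrefl _)⟩
    · exact ⟨x, 0, t, le_rfl, hM0, ht.le, htM, by simp, hx, fun h => absurd h (lt_irrefl _), fun _ => hxd,
        fun h => absurd h (lt_irrefl _)⟩
    · have hv : ODir.vec 2 = -ODir.vec 0 := by simp [ODir.vec]
      refine ⟨x + ODir.vec 2, M - t, 0, by omega, by omega, le_rfl, hM0, ?_, hxd, fun _ => ?_,
        fun h => absurd h (lt_irrefl _), fun _ h => absurd h (lt_irrefl _)⟩
      · rw [hv]; module
      · have : x + ODir.vec 2 + ODir.vec 0 = x := by rw [hv]; abel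
        rw [this]; exact hx
    · have hv : ODir.vec 3 = -ODir.vec 1 := by simp [ODir.vec]
      refine ⟨x + ODir.vec 3, 0, M - t, le_rfl, hM0, by omega, by omega, ?_, hxd,
        fun h => absurd h (lt_irrefl _), fun _ => ?_, fun h => absurd h (lt_irrefl _)⟩
      · rw [hv]; module
      · have : x + ODir.vec 3 + ODir.vec 1 = x := by rw [hv]; abel
        rw [this]; exact hx
  · exact ⟨x, t₁, t₂, h₁.le, h₁M, h₂.le, h₂M, rfl, hx, fun _ => hE, fun _ => hN, fun _ _ => hEN⟩

/-- Membership in `A` of a fine site in the standard frame `(E, N)` at a coarse site. [folklore] -/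
theorem bbt_mem_EN (x : Site 2) (t₁ t₂ : ℤ) (h₁ : 0 ≤ t₁) (h₁M : t₁ < M) (h₂ : 0 ≤ t₂) (h₂M : t₂ < M) :
    (M : ℤ) • x + t₁ • ODir.vec 0 + t₂ • ODir.vec 1 ∈ A ↔ (x ∈ B ∧ (0 < t₁ → x + ODir.vec 0 ∈ B) ∧
      (0 < t₂ → x + ODir.vec 1 ∈ B) ∧ (0 < t₁ → 0 < t₂ → x + ODir.vec 0 + ODir.vec 1 ∈ B)) := by
  constructor
  · intro hf
    obtain ⟨y, s₁, s₂, g₁, g₁M, g₂, g₂M, heq, hy⟩ := bbt_rep hM hA hf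
    obtain ⟨rfl, rfl, rfl⟩ := bbt_rep_unique h₁ h₁M h₂ h₂M g₁ g₁M g₂ g₂M heq
    exact hy
  · rintro ⟨hx, hE, hN, hEN⟩
    rcases h₁.eq_or_lt with rfl | h₁'
    · rcases h₂.eq_or_lt with rfl | h₂'
      · exact (hA _).2 (Or.inl ⟨x, hx, by simp⟩)
      · exact (hA _).2 (Or.inr (Or.inl ⟨x, hx, 1, hN h₂', t₂, h₂', h₂M, by simp⟩))
    · rcases h₂.eq_or_lt with rfl | h₂'
      · exact (hA _).2 (Or.inr (Or.inl ⟨x, hx, 0, hE h₁', t₁, h₁', h₁M, by simp⟩))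
      · exact (hA _).2 (Or.inr (Or.inr ⟨x, hx, hE h₁', hN h₂', hEN h₁' h₂', t₁, t₂, h₁', h₁M, h₂', h₂M, rfl⟩))

/-- **Membership in the fine body, in any frame**: for `0 ≤ t₁, t₂ < M` the fine site
`M • x + t₁ • d + t₂ • d.ccw` lies in `A` iff `x ∈ B` and the corners of the coarse cell that the nonzero offsets
point into lie in `B`. [folklore] -/
theorem bbt_mem_frame (d : ODir) (x : Site 2) (t₁ t₂ : ℤ) (h₁ : 0 ≤ t₁) (h₁M : t₁ < M) (h₂ : 0 ≤ t₂)
    (h₂M : t₂ < M) :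
    (M : ℤ) • x + t₁ • d.vec + t₂ • d.ccw.vec ∈ A ↔ (x ∈ B ∧ (0 < t₁ → x + d.vec ∈ B) ∧
      (0 < t₂ → x + d.ccw.vec ∈ B) ∧ (0 < t₁ → 0 < t₂ → x + d.vec + d.ccw.vec ∈ B)) := by
  have h0 : ∀ (x : Site 2) (t₁ t₂ : ℤ), 0 ≤ t₁ → t₁ < M → 0 ≤ t₂ → t₂ < M →
      ((M : ℤ) • x + t₁ • (0 : ODir).vec + t₂ • (0 : ODir).ccw.vec ∈ A ↔ (x ∈ B ∧ (0 < t₁ → x + (0 : ODir).vec ∈ B) ∧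
        (0 < t₂ → x + (0 : ODir).ccw.vec ∈ B) ∧ (0 < t₁ → 0 < t₂ → x + (0 : ODir).vec + (0 : ODir).ccw.vec ∈ B))) :=
    fun x t₁ t₂ a b c e => bbt_mem_EN hM hA x t₁ t₂ a b c e
  have h1 := bbt_frame_rot 0 h0
  have h2 := bbt_frame_rot _ h1
  have h3 := bbt_frame_rot _ h2
  obtain rfl | rfl | rfl | rfl := bbt_dir_cases d
  exacts [h0 x t₁ t₂ h₁ h₁M h₂ h₂M, h1 x t₁ t₂ h₁ h₁M h₂ h₂M, h2 x t₁ t₂ h₁ h₁M h₂ h₂M,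
    h3 x t₁ t₂ h₁ h₁M h₂ h₂M]

/-- A scaled site `M • x` lies in `A` iff `x ∈ B`. [folklore] -/
theorem bbt_mem_coarse (x : Site 2) : (M : ℤ) • x ∈ A ↔ x ∈ B := by
  have hM0 : (0 : ℤ) < M := by exact_mod_cast (by omega : 0 < M)
  simpa using bbt_mem_frame hM hA 0 x 0 0 le_rfl hM0 le_rfl hM0

/-- A fine site strictly inside the coarse edge from `x` in direction `d` lies in `A` iff both ends are in `B`.
[folklore] -/
theorem bbt_mem_arm (d : ODir) (x : Site 2) {t : ℤ} (ht : 0 < t) (htM : t < M) :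
    (M : ℤ) • x + t • d.vec ∈ A ↔ x ∈ B ∧ x + d.vec ∈ B := by
  have hM0 : (0 : ℤ) < M := by exact_mod_cast (by omega : 0 < M)
  simpa [ht] using bbt_mem_frame hM hA d x t 0 ht.le htM le_rfl hM0

/-- A fine site strictly inside the coarse cell spanned by `d`, `d.ccw` at `x` lies in `A` iff the cell is full.
[folklore] -/
theorem bbt_mem_inner (d : ODir) (x : Site 2) {t₁ t₂ : ℤ} (h₁ : 0 < t₁) (h₁M : t₁ < M) (h₂ : 0 < t₂)
    (h₂M : t₂ < M) : (M : ℤ) • x + t₁ • d.vec + t₂ • d.ccw.vec ∈ A ↔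
      x ∈ B ∧ x + d.vec ∈ B ∧ x + d.ccw.vec ∈ B ∧ x + d.vec + d.ccw.vec ∈ B := by
  simpa [h₁, h₂] using bbt_mem_frame hM hA d x t₁ t₂ h₁.le h₁M h₂.le h₂M

/-! ### Fine steps of the wall follower -/

/-- A coarse boundary edge scales to a fine boundary edge. [folklore] -/
theorem bbt_isBEdge_scale {x : Site 2} {d : ODir} (he : IsBEdge (↑B : Set (Site 2)) (x, d)) :
    IsBEdge (↑A : Set (Site 2)) ((M : ℤ) • x, d) := by
  obtain ⟨hx, hxd⟩ := he
  simp only [Finset.mem_coe] at hx hxd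
  refine ⟨(bbt_mem_coarse hM hA x).2 hx, fun h => hxd ?_⟩
  have h' : (M : ℤ) • x + (1 : ℤ) • d.vec ∈ A := by simpa using h
  exact ((bbt_mem_arm hM hA d x one_pos (by omega)).1 h').2

/-- Convex coarse corner: the fine tour turns left at once. [folklore] -/
theorem bbt_left_step {x : Site 2} {d : ODir} (ha : x + d.ccw.vec ∉ B) :
    bnext (↑A : Set (Site 2)) ((M : ℤ) • x, d) = ((M : ℤ) • x, d.ccw) := by
  apply bnext_eq_of_notMem
  rw [Finset.mem_coe, show (M : ℤ) • x + d.ccw.vec = (M : ℤ) • x + (1 : ℤ) • d.ccw.vec by rw [one_smul]]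
  exact fun h => ha ((bbt_mem_arm hM hA d.ccw x one_pos (by omega)).1 h).2

/-- A straight fine step along the arm of a coarse boundary edge. [folklore] -/
theorem bbt_arm_step {x : Site 2} {d : ODir} (hx : x ∈ B) (hxd : x + d.vec ∉ B) (ha : x + d.ccw.vec ∈ B)
    (k : ℕ) (hk : k + 1 < M) :
    bnext (↑A : Set (Site 2)) ((M : ℤ) • x + (k : ℤ) • d.ccw.vec, d) =
      ((M : ℤ) • x + ((k : ℤ) + 1) • d.ccw.vec, d) := by
  have h1 : (M : ℤ) • x + (k : ℤ) • d.ccw.vec + d.ccw.vec = (M : ℤ) • x + ((k : ℤ) + 1) • d.ccw.vec := by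
    module
  have h2 : (M : ℤ) • x + (k : ℤ) • d.ccw.vec + d.vec + d.ccw.vec =
      (M : ℤ) • x + (1 : ℤ) • d.vec + ((k : ℤ) + 1) • d.ccw.vec := by
    module
  have ha' : (M : ℤ) • x + (k : ℤ) • d.ccw.vec + d.ccw.vec ∈ (↑A : Set (Site 2)) := by
    rw [Finset.mem_coe, h1]
    exact (bbt_mem_arm hM hA d.ccw x (by positivity) (by omega)).2 ⟨hx, ha⟩
  have ho' : (M : ℤ) • x + (k : ℤ) • d.ccw.vec + d.vec + d.ccw.vec ∉ (↑A : Set (Site 2)) := by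
    rw [Finset.mem_coe, h2]
    exact fun h => hxd ((bbt_mem_inner hM hA d x one_pos (by omega) (by positivity)
      (by omega)).1 h).2.1
  rw [bnext_eq_of_mem_of_notMem ha' ho', h1]

/-- The last fine step along the arm, flat coarse boundary: straight on to the scaled next edge. [folklore] -/
theorem bbt_arm_last {x : Site 2} {d : ODir} (ha : x + d.ccw.vec ∈ B) (ho : x + d.vec + d.ccw.vec ∉ B) :
    bnext (↑A : Set (Site 2)) ((M : ℤ) • x + ((M : ℤ) - 1) • d.ccw.vec, d) = ((M : ℤ) • (x + d.ccw.vec), d) := by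
  have h1 : (M : ℤ) • x + ((M : ℤ) - 1) • d.ccw.vec + d.ccw.vec = (M : ℤ) • (x + d.ccw.vec) := by module
  have h2 : (M : ℤ) • x + ((M : ℤ) - 1) • d.ccw.vec + d.vec + d.ccw.vec =
      (M : ℤ) • (x + d.ccw.vec) + (1 : ℤ) • d.vec := by
    module
  have ha' : (M : ℤ) • x + ((M : ℤ) - 1) • d.ccw.vec + d.ccw.vec ∈ (↑A : Set (Site 2)) := by
    rw [Finset.mem_coe, h1]
    exact (bbt_mem_coarse hM hA _).2 ha
  have ho' : (M : ℤ) • x + ((M : ℤ) - 1) • d.ccw.vec + d.vec + d.ccw.vec ∉ (↑A : Set (Site 2)) := by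
    rw [Finset.mem_coe, h2]
    intro h
    have := ((bbt_mem_arm hM hA d (x + d.ccw.vec) one_pos (by omega)).1 h).2
    rw [add_right_comm] at this
    exact ho this
  rw [bnext_eq_of_mem_of_notMem ha' ho', h1]

/-- The last fine step along the arm, reflex coarse corner: the fine tour turns right. [folklore] -/
theorem bbt_arm_turn {x : Site 2} {d : ODir} (ha : x + d.ccw.vec ∈ B) (ho : x + d.vec + d.ccw.vec ∈ B) :
    bnext (↑A : Set (Site 2)) ((M : ℤ) • x + ((M : ℤ) - 1) • d.ccw.vec, d) =
      ((M : ℤ) • (x + d.ccw.vec) + (1 : ℤ) • d.vec, d.cw) := by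
  have h1 : (M : ℤ) • x + ((M : ℤ) - 1) • d.ccw.vec + d.ccw.vec = (M : ℤ) • (x + d.ccw.vec) := by module
  have h2 : (M : ℤ) • x + ((M : ℤ) - 1) • d.ccw.vec + d.vec + d.ccw.vec =
      (M : ℤ) • (x + d.ccw.vec) + (1 : ℤ) • d.vec := by
    module
  have ha' : (M : ℤ) • x + ((M : ℤ) - 1) • d.ccw.vec + d.ccw.vec ∈ (↑A : Set (Site 2)) := by
    rw [Finset.mem_coe, h1]
    exact (bbt_mem_coarse hM hA _).2 ha
  have ho' : (M : ℤ) • x + ((M : ℤ) - 1) • d.ccw.vec + d.vec + d.ccw.vec ∈ (↑A : Set (Site 2)) := by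
    rw [Finset.mem_coe, h2]
    exact (bbt_mem_arm hM hA d (x + d.ccw.vec) one_pos (by omega)).2 ⟨ha, by rwa [add_right_comm]⟩
  rw [bnext_eq_of_mem_of_mem ha' ho', h2]

/-- A straight fine step after the right turn, along the second arm of a reflex coarse corner. [folklore] -/
theorem bbt_turn_step {x : Site 2} {d : ODir} (hxd : x + d.vec ∉ B) (ha : x + d.ccw.vec ∈ B)
    (ho : x + d.vec + d.ccw.vec ∈ B) (j : ℕ) (hj : j + 1 ≤ M) :
    bnext (↑A : Set (Site 2)) ((M : ℤ) • (x + d.ccw.vec) + (j : ℤ) • d.vec, d.cw) =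
      ((M : ℤ) • (x + d.ccw.vec) + ((j : ℤ) + 1) • d.vec, d.cw) := by
  have h1 : (M : ℤ) • (x + d.ccw.vec) + (j : ℤ) • d.vec + d.cw.ccw.vec =
      (M : ℤ) • (x + d.ccw.vec) + ((j : ℤ) + 1) • d.vec := by
    rw [ODir.ccw_cw]; module
  have h2 : (M : ℤ) • (x + d.ccw.vec) + (j : ℤ) • d.vec + d.cw.vec + d.cw.ccw.vec =
      (M : ℤ) • x + ((j : ℤ) + 1) • d.vec + ((M : ℤ) - 1) • d.ccw.vec := by
    rw [ODir.ccw_cw, ODir.vec_cw]; module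
  have ha' : (M : ℤ) • (x + d.ccw.vec) + (j : ℤ) • d.vec + d.cw.ccw.vec ∈ (↑A : Set (Site 2)) := by
    rw [Finset.mem_coe, h1]
    rcases Nat.lt_or_eq_of_le hj with hlt | heq
    · exact (bbt_mem_arm hM hA d _ (by positivity) (by omega)).2 ⟨ha, by rwa [add_right_comm]⟩
    · have hj' : (j : ℤ) + 1 = M := by exact_mod_cast heq
      rw [hj', show (M : ℤ) • (x + d.ccw.vec) + (M : ℤ) • d.vec = (M : ℤ) • (x + d.vec + d.ccw.vec) by module]
      exact (bbt_mem_coarse hM hA _).2 ho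
  have ho' : (M : ℤ) • (x + d.ccw.vec) + (j : ℤ) • d.vec + d.cw.vec + d.cw.ccw.vec ∉ (↑A : Set (Site 2)) := by
    rw [Finset.mem_coe, h2]
    rcases Nat.lt_or_eq_of_le hj with hlt | heq
    · exact fun h => hxd ((bbt_mem_inner hM hA d x (by positivity) (by omega) (by omega)
        (by omega)).1 h).2.1
    · have hj' : (j : ℤ) + 1 = M := by exact_mod_cast heq
      rw [hj', show (M : ℤ) • x + (M : ℤ) • d.vec + ((M : ℤ) - 1) • d.ccw.vec =
        (M : ℤ) • (x + d.vec) + ((M : ℤ) - 1) • d.ccw.vec by module]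
      exact fun h => hxd ((bbt_mem_arm hM hA d.ccw (x + d.vec) (by omega) (by omega)).1 h).1
  rw [bnext_eq_of_mem_of_notMem ha' ho', h1]

/-- The fine tour along the arm of a coarse boundary edge whose pixel ahead is in `B`. [folklore] -/
theorem bbt_arm_tour {x : Site 2} {d : ODir} (hx : x ∈ B) (hxd : x + d.vec ∉ B) (ha : x + d.ccw.vec ∈ B) :
    ∀ k : ℕ, k + 1 ≤ M →
      btour (↑A : Set (Site 2)) ((M : ℤ) • x, d) k = ((M : ℤ) • x + (k : ℤ) • d.ccw.vec, d) := by
  intro k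
  induction k with
  | zero => intro; simp
  | succ k ih =>
    intro hk
    rw [btour_succ, ih (by omega), bbt_arm_step hM hA hx hxd ha k (by omega)]
    push_cast
    rfl

/-- The fine tour after the right turn at a reflex coarse corner. [folklore] -/
theorem bbt_turn_tour {x : Site 2} {d : ODir} (hx : x ∈ B) (hxd : x + d.vec ∉ B) (ha : x + d.ccw.vec ∈ B)
    (ho : x + d.vec + d.ccw.vec ∈ B) :
    ∀ j : ℕ, 1 ≤ j → j ≤ M → btour (↑A : Set (Site 2)) ((M : ℤ) • x, d) (M - 1 + j) =
      ((M : ℤ) • (x + d.ccw.vec) + (j : ℤ) • d.vec, d.cw) := by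
  intro j hj
  induction j, hj using Nat.le_induction with
  | base =>
    intro
    have hc : ((M - 1 : ℕ) : ℤ) = (M : ℤ) - 1 := by omega
    rw [btour_succ, bbt_arm_tour hM hA hx hxd ha (M - 1) (by omega), hc, bbt_arm_turn hM hA ha ho,
      Nat.cast_one]
  | succ j _ ih =>
    intro hjM
    rw [← add_assoc, btour_succ, ih (by omega), bbt_turn_step hM hA hxd ha ho j (by omega)]
    push_cast
    rfl

end Mem

/-- **Registered part `bbt_step`: ONE-STEP SIMULATION.**  For a boundary edge `(x, d)` of `B`, the wall-follower
tour of the fine body `A` started at the scaled edge `(M • x, d)` reaches the scaled successor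
`bnext B (x, d)` after `L` steps, `1 ≤ L ≤ 2M - 1` (`L = 1` at a convex corner, `M` along a flat boundary,
`2M - 1` at a reflex corner), and before that it runs through the explicitly listed fine edges: the arm
`(M • x + r • d.ccw, d)` for `r < M`, then `(M • (x + d.ccw) + (r - M + 1) • d, d.cw)`. [folklore] -/
theorem bbt_step : ∀ (B A : Finset (Site 2)) (M : ℕ), 2 ≤ M → (∀ f : Site 2, f ∈ A ↔ ((∃ x ∈ B, f = (M : ℤ) • x) ∨ (∃ x ∈ B, ∃ d : ODir, x + d.vec ∈ B ∧ ∃ t : ℤ, 0 < t ∧ t < M ∧ f = (M : ℤ) • x + t • d.vec) ∨ (∃ x ∈ B, x + ODir.vec 0 ∈ B ∧ x + ODir.vec 1 ∈ B ∧ x + ODir.vec 0 + ODir.vec 1 ∈ B ∧ ∃ t₁ t₂ : ℤ, 0 < t₁ ∧ t₁ < M ∧ 0 < t₂ ∧ t₂ < M ∧ f = (M : ℤ) • x + t₁ • ODir.vec 0 + t₂ • ODir.vec 1))) → ∀ (x : Site 2) (d : ODir), IsBEdge (↑B : Set (Site 2)) (x, d) → ∃ L : ℕ, 0 < L ∧ L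 ≤ 2 * M - 1 ∧ btour (↑A : Set (Site 2)) ((M : ℤ) • x, d) L = ((M : ℤ) • (bnext (↑B : Set (Site 2)) (x, d)).1, (bnext (↑B : Set (Site 2)) (x, d)).2) ∧ ∀ r : ℕ, r < L → btour (↑A : Set (Site 2)) ((M : ℤ) • x, d) r = (if r < M then ((M : ℤ) • x + (r : ℤ) • d.ccw.vec, d) else ((M : ℤ) • (x + d.ccw.vec) + ((r : ℤ) - M + 1) • d.vec, d.cw)) := by
  intro B A M hM hA x d he
  obtain ⟨hx, hxd⟩ := he
  simp only [Finset.mem_coe] at hx hxd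
  rcases bnext_cases (↑B : Set (Site 2)) x d with ⟨ha, hb⟩ | ⟨ha, ho, hb⟩ | ⟨ha, ho, hb⟩
  · rw [Finset.mem_coe] at ha
    refine ⟨1, one_pos, by omega, ?_, ?_⟩
    · rw [hb, btour_succ, btour_zero, bbt_left_step hM hA ha]
    · intro r hr
      obtain rfl : r = 0 := by omega
      simp [show 0 < M by omega]
  · rw [Finset.mem_coe] at ha ho
    refine ⟨M, by omega, by omega, ?_, ?_⟩
    · have hs : btour (↑A : Set (Site 2)) ((M : ℤ) • x, d) M =
          bnext (↑A : Set (Site 2)) (btour (↑A : Set (Site 2)) ((M : ℤ) • x, d) (M - 1)) := by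
        rw [← btour_succ]; congr 1; omega
      have hc : ((M - 1 : ℕ) : ℤ) = (M : ℤ) - 1 := by omega
      rw [hb, hs, bbt_arm_tour hM hA hx hxd ha (M - 1) (by omega), hc, bbt_arm_last hM hA ha ho]
    · intro r hr
      rw [if_pos hr, bbt_arm_tour hM hA hx hxd ha r (by omega)]
  · rw [Finset.mem_coe] at ha ho
    refine ⟨2 * M - 1, by omega, le_rfl, ?_, ?_⟩
    · rw [hb, show 2 * M - 1 = M - 1 + M by omega, bbt_turn_tour hM hA hx hxd ha ho M (by omega) le_rfl]
      simp only [smul_add]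
      abel_nf
    · intro r hr
      split_ifs with hrM
      · exact bbt_arm_tour hM hA hx hxd ha r (by omega)
      · obtain ⟨j, rfl⟩ : ∃ j, r = M - 1 + j := ⟨r + 1 - M, by omega⟩
        have hc : ((M - 1 + j : ℕ) : ℤ) - M + 1 = j := by omega
        rw [bbt_turn_tour hM hA hx hxd ha ho j (by omega) (by omega), hc]


end Summit.CriticalPhenomena.SAWScalingLimit.Theorems.FKGToTraversalBound.SlitNecklace

end
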